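import Literature.Algebra.Polynomial.CircuitOptimalConstant

/-!
# Two worked minima of circuit polynomials from Iliman–de Wolff's GP paper, exactly

[cite: IlimanDewolff2016GP, §4.1 (Examples), first example («consider the polynomial
f = 1/4 + x_1^8 + x_1^2 x_2^6 + 4 x_1^3 x_2^3 … The optimal solution is given by
a_{α,1} = a_{α,2} = 1 yielding m* = 4 and hence f_gp = 1/4 − 4 = −3.75 = f_sos = f*») and second
example («f = 187/208 + x_1^{80} + x_2^{78} − 8 x_1^5 x_2^3 … Using the software Gloptipoly …
f* ≈ −5.6179 was computed in 4327.2 seconds … we get …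
f* = λ_0 − m* = 187/208 · (1 − (8^{208}/(16^{13} · 26^8))^{1/187}) ≈ −5.6179 in 0.5 seconds»)]
[cite: IlimanDewolff2016, Theorem 3.8 (the circuit number)]

Both polynomials are proper circuit polynomials with a constant vertex, so the companion file's
closed form `min_{ℝ²} p = b₀ (1 − (|c|/Θ)^{1/λ₀})`
(`CircuitOptimalConstant.isLeast_circuitPolynomial`) applies and reproduces the printed optimal
values EXACTLY, as kernel-checked real-number identities:

* `p₁ = 1/4 + x⁸ + x² y⁶ + 4 x³ y³`: vertices `(0,0), (8,0), (2,6)`, inner point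
  `(3,3) = ¼(0,0) + ¼(8,0) + ½(2,6)`, `Θ = 1 · 4^{1/4} · 2^{1/2} = 2`, `λ₀ = ¼`, `|c| = 4`:
  `min p₁ = ¼ (1 − 2⁴) = −15/4 = −3.75` (`isLeast_example₁`);
* `p₂ = 187/208 + x^{80} + y^{78} − 8 x⁵ y³`: vertices `(0,0), (80,0), (0,78)`, inner point
  `(5,3) = (1/16)(80,0) + (1/26)(0,78)`, `λ₀ = 187/208 = b₀`, `Θ = 16^{1/16} · 26^{1/26}`,
  `|c| = 8`:
  `min p₂ = (187/208)(1 − (8^{208}/(16^{13}·26^{8}))^{1/187})` (`isLeast_example₂`), the number the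
  source reports as `≈ −5.6179` after 1.2 hours of SDP versus 0.5 s of GP.

All statements are fully proved; no named facts are introduced.
-/

namespace Literature.Algebra.Polynomial.CircuitMinimumExamples

open Finset Matrix Literature.Algebra.Polynomial.CircuitNumberNonnegativity
open Literature.Algebra.Polynomial.CircuitNormMinimiser
open Literature.Algebra.Polynomial.CircuitOptimalConstant

/-! ### Affine independence of a triangle with a horizontal edge -/

/-- Three points `(0,0), (u,0), (s,t)` of `ℝ²` with `u ≠ 0`, `t ≠ 0` are affinely independent
(they are not collinear). [folklore] -/
private theorem affineIndependent_triangle {u s t : ℝ} (hu : u ≠ 0) (ht : t ≠ 0) :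
    AffineIndependent ℝ (![![0, 0], ![u, 0], ![s, t]] : Fin 3 → Fin 2 → ℝ) := by
  rw [affineIndependent_iff_not_collinear_set]
  intro hcol
  rw [collinear_iff_of_mem (p₀ := (![0, 0] : Fin 2 → ℝ)) (by simp)] at hcol
  obtain ⟨v, hv⟩ := hcol
  obtain ⟨r₁, hr₁⟩ := hv ![u, 0] (by simp)
  obtain ⟨r₂, hr₂⟩ := hv ![s, t] (by simp)
  have e0 := congr_fun hr₁ 0
  have e1 := congr_fun hr₁ 1
  have f1 := congr_fun hr₂ 1
  simp at e0 e1 f1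
  rcases e1 with h | h
  · rw [h, zero_mul] at e0
    exact hu e0
  · rw [h, mul_zero] at f1
    exact ht f1

/-! ### Example 1: `1/4 + x⁸ + x² y⁶ + 4 x³ y³`, minimum `−15/4` -/

section Example1

/-- The circuit form with `b = (¼, 1, 1)`, outer exponents `(0,0), (8,0), (2,6)`, inner exponent
`(3,3)` and `c = 4` evaluates to `¼ + x₀⁸ + x₀² x₁⁶ + 4 x₀³ x₁³`.
[cite: IlimanDewolff2016GP, §4.1, first example] -/
theorem eval_example₁ (x : Fin 2 → ℝ) :
    ∑ j : Fin 3, (![1 / 4, 1, 1] : Fin 3 → ℝ) j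
        * ∏ i : Fin 2, x i ^ (![![0, 0], ![8, 0], ![2, 6]] : Fin 3 → Fin 2 → ℕ) j i
      + 4 * ∏ i : Fin 2, x i ^ (![3, 3] : Fin 2 → ℕ) i
      = 1 / 4 + x 0 ^ 8 + x 0 ^ 2 * x 1 ^ 6 + 4 * x 0 ^ 3 * x 1 ^ 3 := by
  simp [Fin.sum_univ_three, Fin.prod_univ_two]
  ring

/-- Its circuit number: `Θ = ((¼)/(¼))^{¼} · (1/(¼))^{¼} · (1/(½))^{½} = 4^{1/4} · 2^{1/2} = 2`.
[cite: IlimanDewolff2016GP, §4.1, first example (the GP data ¼ · 4⁴ · (¼)^{4/4} · (½)^{4/2})] -/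
theorem circuitNumber_example₁ :
    circuitNumber (![1 / 4, 1, 1] : Fin 3 → ℝ) ![1 / 4, 1 / 4, 1 / 2] = 2 := by
  rw [circuitNumber, Fin.prod_univ_three]
  simp only [cons_val_zero, cons_val_one, head_cons, cons_val_two, tail_cons]
  have h4 : ((1 : ℝ) / (1 / 4)) ^ ((1 : ℝ) / 4) = 2 ^ ((1 : ℝ) / 2) := by
    rw [show ((1 : ℝ) / (1 / 4)) = 2 ^ (2 : ℝ) by norm_num, ← Real.rpow_mul (by norm_num)]
    norm_num
  rw [h4, show ((1 : ℝ) / 4 / (1 / 4)) = 1 by norm_num, Real.one_rpow, one_mul,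
    show ((1 : ℝ) / (1 / 2)) = 2 by norm_num, ← Real.rpow_add (by norm_num : (0 : ℝ) < 2)]
  norm_num

/-- **`min_{ℝ²} (¼ + x⁸ + x² y⁶ + 4 x³ y³) = −15/4 = −3.75`**, attained — the source's
`f_gp = f_sos = f* = −3.75`, here from the closed form `b₀(1 − (|c|/Θ)^{1/λ₀}) = ¼(1 − (4/2)⁴)`.
[cite: IlimanDewolff2016GP, §4.1, first example («m* = 4 and hence
f_gp = 1/4 − 4 = −3.75 = f_sos = f*»)] -/
theorem isLeast_example₁ :
    IsLeast (Set.range fun x : Fin 2 → ℝ =>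
      1 / 4 + x 0 ^ 8 + x 0 ^ 2 * x 1 ^ 6 + 4 * x 0 ^ 3 * x 1 ^ 3) (-15 / 4) := by
  have hb : ∀ j, 0 < (![1 / 4, 1, 1] : Fin 3 → ℝ) j := by
    intro j; fin_cases j <;> simp
  have hw : ∀ j, 0 < (![1 / 4, 1 / 4, 1 / 2] : Fin 3 → ℝ) j := by
    intro j; fin_cases j <;> simp
  have hw1 : ∑ j, (![1 / 4, 1 / 4, 1 / 2] : Fin 3 → ℝ) j = 1 := by
    simp [Fin.sum_univ_three]; norm_num
  have ha : ∀ j i, Even ((![![0, 0], ![8, 0], ![2, 6]] : Fin 3 → Fin 2 → ℕ) j i) := by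
    intro j i; fin_cases j <;> fin_cases i <;> decide
  have hα : AffineIndependent ℝ
      (fun j i => ((![![0, 0], ![8, 0], ![2, 6]] : Fin 3 → Fin 2 → ℕ) j i : ℝ)) := by
    have h : (fun j i => ((![![0, 0], ![8, 0], ![2, 6]] : Fin 3 → Fin 2 → ℕ) j i : ℝ))
        = (![![0, 0], ![8, 0], ![2, 6]] : Fin 3 → Fin 2 → ℝ) := by
      funext j i; fin_cases j <;> fin_cases i <;> simp
    rw [h]
    exact affineIndependent_triangle (by norm_num) (by norm_num)
  have hβ : ∀ i : Fin 2, (((![3, 3] : Fin 2 → ℕ) i : ℕ) : ℝ)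
      = ∑ j, (![1 / 4, 1 / 4, 1 / 2] : Fin 3 → ℝ) j
        * (((![![0, 0], ![8, 0], ![2, 6]] : Fin 3 → Fin 2 → ℕ) j i : ℕ) : ℝ) := by
    intro i; fin_cases i <;> simp [Fin.sum_univ_three] <;> norm_num
  have hj₀ : ∀ i : Fin 2, (![![0, 0], ![8, 0], ![2, 6]] : Fin 3 → Fin 2 → ℕ) 0 i = 0 := by
    intro i; fin_cases i <;> simp
  have hprop : (4 : ℝ) < 0 ∨ ∃ i : Fin 2, Odd ((![3, 3] : Fin 2 → ℕ) i) :=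
    Or.inr ⟨0, by decide⟩
  have key := isLeast_circuitPolynomial hb hw hw1 ha hα hβ hj₀ (c := 4) (by norm_num) hprop
  simp_rw [eval_example₁] at key
  rw [circuitNumber_example₁] at key
  have hval : (![1 / 4, 1, 1] : Fin 3 → ℝ) 0
      * (1 - (|(4 : ℝ)| / 2) ^ (1 / (![1 / 4, 1 / 4, 1 / 2] : Fin 3 → ℝ) 0)) = -15 / 4 := by
    simp only [cons_val_zero]
    rw [abs_of_pos (by norm_num : (0 : ℝ) < 4), show ((4 : ℝ) / 2) = 2 by norm_num,
      show ((1 : ℝ) / (1 / 4)) = (4 : ℕ) by norm_num, Real.rpow_natCast]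
    norm_num
  rw [hval] at key
  exact key

/-- The same in two real variables: for all `x, y`, `−15/4 ≤ ¼ + x⁸ + x² y⁶ + 4 x³ y³`, with
equality somewhere.
[cite: IlimanDewolff2016GP, §4.1, first example] -/
theorem example₁_min (x y : ℝ) : -15 / 4 ≤ 1 / 4 + x ^ 8 + x ^ 2 * y ^ 6 + 4 * x ^ 3 * y ^ 3 :=
  isLeast_example₁.2 ⟨![x, y], by simp⟩

/-- … and the bound `−15/4` is a value of `¼ + x⁸ + x² y⁶ + 4 x³ y³`.
[cite: IlimanDewolff2016GP, §4.1, first example (f* = −3.75)] -/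
theorem example₁_min_attained :
    ∃ x y : ℝ, 1 / 4 + x ^ 8 + x ^ 2 * y ^ 6 + 4 * x ^ 3 * y ^ 3 = -15 / 4 := by
  obtain ⟨v, hv⟩ := isLeast_example₁.1
  exact ⟨v 0, v 1, hv⟩

end Example1

/-! ### Example 2: `187/208 + x^{80} + y^{78} − 8 x⁵ y³` -/

section Example2

/-- The circuit form with `b = (187/208, 1, 1)`, outer exponents `(0,0), (80,0), (0,78)`, inner
exponent `(5,3)` and `c = −8` evaluates to `187/208 + x₀^{80} + x₁^{78} − 8 x₀⁵ x₁³`.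
[cite: IlimanDewolff2016GP, §4.1, second example] -/
theorem eval_example₂ (x : Fin 2 → ℝ) :
    ∑ j : Fin 3, (![187 / 208, 1, 1] : Fin 3 → ℝ) j
        * ∏ i : Fin 2, x i ^ (![![0, 0], ![80, 0], ![0, 78]] : Fin 3 → Fin 2 → ℕ) j i
      + (-8) * ∏ i : Fin 2, x i ^ (![5, 3] : Fin 2 → ℕ) i
      = 187 / 208 + x 0 ^ 80 + x 1 ^ 78 - 8 * (x 0 ^ 5 * x 1 ^ 3) := by
  simp [Fin.sum_univ_three, Fin.prod_univ_two]
  ring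

/-- Its circuit number: `Θ = 1 · 16^{1/16} · 26^{1/26}` (`b₀ = λ₀ = 187/208`).
[cite: IlimanDewolff2016GP, §4.1, second example (λ_1 = 1/16, λ_2 = 1/26)] -/
theorem circuitNumber_example₂ :
    circuitNumber (![187 / 208, 1, 1] : Fin 3 → ℝ) ![187 / 208, 1 / 16, 1 / 26]
      = 16 ^ ((1 : ℝ) / 16) * 26 ^ ((1 : ℝ) / 26) := by
  rw [circuitNumber, Fin.prod_univ_three]
  simp only [cons_val_zero, cons_val_one, head_cons, cons_val_two, tail_cons]
  rw [div_self (by norm_num : (187 : ℝ) / 208 ≠ 0), Real.one_rpow, one_mul]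
  norm_num

/-- The closed form in the source's shape: `(187/208)(1 − (8 / (16^{1/16} 26^{1/26}))^{208/187})`
equals `(187/208)(1 − (8^{208}/(16^{13}·26^{8}))^{1/187})`.
[cite: IlimanDewolff2016GP, §4.1, second example
(m* = 187/208 · (8^{208}/(16^{13}·26^8))^{1/187})] -/
theorem example₂_value :
    (187 : ℝ) / 208 * (1 - (|(-8 : ℝ)| / (16 ^ ((1 : ℝ) / 16) * 26 ^ ((1 : ℝ) / 26)))
        ^ (1 / ((187 : ℝ) / 208)))
      = 187 / 208 * (1 - ((8 : ℝ) ^ (208 : ℕ) / (16 ^ (13 : ℕ) * 26 ^ (8 : ℕ)))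
        ^ ((1 : ℝ) / 187)) := by
  congr 2
  have h8 : (8 : ℝ) = ((8 : ℝ) ^ (208 : ℕ)) ^ ((1 : ℝ) / 208) := by
    rw [← Real.rpow_natCast, ← Real.rpow_mul (by norm_num)]; norm_num
  have h16 : (16 : ℝ) ^ ((1 : ℝ) / 16) = ((16 : ℝ) ^ (13 : ℕ)) ^ ((1 : ℝ) / 208) := by
    rw [← Real.rpow_natCast, ← Real.rpow_mul (by norm_num)]; norm_num
  have h26 : (26 : ℝ) ^ ((1 : ℝ) / 26) = ((26 : ℝ) ^ (8 : ℕ)) ^ ((1 : ℝ) / 208) := by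
    rw [← Real.rpow_natCast, ← Real.rpow_mul (by norm_num)]; norm_num
  rw [abs_neg, abs_of_pos (by norm_num : (0 : ℝ) < 8), h8, h16, h26,
    ← Real.mul_rpow (by positivity) (by positivity),
    ← Real.div_rpow (by positivity) (by positivity), ← Real.rpow_mul (by positivity)]
  norm_num

/-- **`min_{ℝ²} (187/208 + x^{80} + y^{78} − 8 x⁵ y³)`
`= (187/208)(1 − (8^{208}/(16^{13}·26^{8}))^{1/187})`**, attained — the exact value behind the
source's `f* ≈ −5.6179` (Gloptipoly: 1.2 h; GP: 0.5 s).
[cite: IlimanDewolff2016GP, §4.1, second example] -/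
theorem isLeast_example₂ :
    IsLeast
      (Set.range fun x : Fin 2 → ℝ => 187 / 208 + x 0 ^ 80 + x 1 ^ 78 - 8 * (x 0 ^ 5 * x 1 ^ 3))
      (187 / 208
        * (1 - ((8 : ℝ) ^ (208 : ℕ) / (16 ^ (13 : ℕ) * 26 ^ (8 : ℕ))) ^ ((1 : ℝ) / 187))) := by
  have hb : ∀ j, 0 < (![187 / 208, 1, 1] : Fin 3 → ℝ) j := by
    intro j; fin_cases j <;> simp
  have hw : ∀ j, 0 < (![187 / 208, 1 / 16, 1 / 26] : Fin 3 → ℝ) j := by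
    intro j; fin_cases j <;> simp
  have hw1 : ∑ j, (![187 / 208, 1 / 16, 1 / 26] : Fin 3 → ℝ) j = 1 := by
    simp [Fin.sum_univ_three]; norm_num
  have ha : ∀ j i, Even ((![![0, 0], ![80, 0], ![0, 78]] : Fin 3 → Fin 2 → ℕ) j i) := by
    intro j i; fin_cases j <;> fin_cases i <;> decide
  have hα : AffineIndependent ℝ
      (fun j i => ((![![0, 0], ![80, 0], ![0, 78]] : Fin 3 → Fin 2 → ℕ) j i : ℝ)) := by
    have h : (fun j i => ((![![0, 0], ![80, 0], ![0, 78]] : Fin 3 → Fin 2 → ℕ) j i : ℝ))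
        = (![![0, 0], ![80, 0], ![0, 78]] : Fin 3 → Fin 2 → ℝ) := by
      funext j i; fin_cases j <;> fin_cases i <;> simp
    rw [h]
    exact affineIndependent_triangle (by norm_num) (by norm_num)
  have hβ : ∀ i : Fin 2, (((![5, 3] : Fin 2 → ℕ) i : ℕ) : ℝ)
      = ∑ j, (![187 / 208, 1 / 16, 1 / 26] : Fin 3 → ℝ) j
        * (((![![0, 0], ![80, 0], ![0, 78]] : Fin 3 → Fin 2 → ℕ) j i : ℕ) : ℝ) := by
    intro i; fin_cases i <;> simp [Fin.sum_univ_three] <;> norm_num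
  have hj₀ : ∀ i : Fin 2, (![![0, 0], ![80, 0], ![0, 78]] : Fin 3 → Fin 2 → ℕ) 0 i = 0 := by
    intro i; fin_cases i <;> simp
  have hprop : (-8 : ℝ) < 0 ∨ ∃ i : Fin 2, Odd ((![5, 3] : Fin 2 → ℕ) i) := Or.inl (by norm_num)
  have key := isLeast_circuitPolynomial hb hw hw1 ha hα hβ hj₀ (c := -8) (by norm_num) hprop
  simp_rw [eval_example₂] at key
  rw [circuitNumber_example₂] at key
  simp only [cons_val_zero] at key
  rw [example₂_value] at key
  exact key

end Example2

end Literature.Algebra.Polynomial.CircuitMinimumExamples
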